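/-
Copyright (c) 2026 the pub-hodgecm-mathlib formalisation cell (harness21).  Prover seat hodgecm-mathlib-LH4-p05 (g10) (Track A hand on the K2-lead VALVE), hLiu418 =
`stmt-HodgeConjecture-24832`; #42F′ FACE-G L2 organ (W-orb) — THE DEALT FILE (LEAD F0P6-plan (g14) BATCH #137 (1); desks K2Liu-p10 (g6), K2Liu-p09 (g8); chair K2-lead (g2)).
-/
import Summits.HodgeConjecture.HodgeConjecture.Theorems.K2LiuFaceGThetaOrbitModel              -- ★ p863615 (this seat): F-a + the PRODUCT LAW `archWeilRep_fst_placeSecJ_tensorPi`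
import Summits.HodgeConjecture.HodgeConjecture.Theorems.K2LiuArchOrbitLawOfProductLaw           -- ★ p863585 (K2Liu-p10): `thetaOrbitLetter_of_productLaw` (the head modulo `hprod`)
import Summits.HodgeConjecture.HodgeConjecture.Theorems.K2LiuArchSkewPlaceChart                -- ★ p863534 (K2Liu-p09): `exists_lie_expGL_eq_placeSecJ_expMem_of_single` (the chart)
import Summits.HodgeConjecture.HodgeConjecture.Theorems.K2LiuWeilDatumLieDerivativeCLM          -- ★ p863434 (K2Liu-p09): `exists_clm_hasDerivAt_weilDatum_expMem_smul` ((G2-W2) in operator form)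
import Summits.HodgeConjecture.HodgeConjecture.Theorems.K2LiuSwSectionArchOrbitDeriv            -- ★ (K2Liu-p05): `contDiffAt_coe_etaD_placeSecJ_expMem`, `expMem_zero_smul`
import Summits.HodgeConjecture.HodgeConjecture.Theorems.K2LiuArchTensorPlaceSec                 -- ★ `exists_cmPlaceOver_eq`
import Literature.NumberTheory.GelbartRogawski1991.CMSplittingCharArchComponents              -- ★ `IsSplittingChar.exists_hasUnitaryArchType_odd`
import HarnessLib

/-!
# Crux `HLiu418`, #42F′ FACE-G, organ (W-orb) — `K2LiuFaceGThetaOrbitLetter`: EVERY `𝓢(X_∞)`-ORBIT OF THE SMALL PAIR'S ARCHIMEDEAN WEIL REPRESENTATION IS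
# DIFFERENTIABLE ALONG `t ↦ (exp tX, 1)` FOR A SINGLE-PLACE `X` — the `hWorb` binder of ★ p863031, hypothesis-free at the `DX` of record

Cell `hodgecm-mathlib`, hLiu418 = `stmt-HodgeConjecture-24832`, route `HCCMUnconditional`; squad K2 ∕ K2Liu, socket #42F′, FACE-G organ plan (RULING M-158q (a)); lane
`--supports stmt-HodgeConjecture-24832 --as helper` (count-neutral).  THEOREMS ONLY (no `def`, no `instance`, no `notation`, no named-fact hypothesis, no `sorry`).

THE ASSEMBLY (road (C2) of the (W-orb) board, K2 bus 2026-09-04T23:30Z–2026-09-05T00:30Z).  For `X ∈ 𝔲(J^𝔻)` supported at ONE complex place `w₀` (the `DX` of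
record, K2Liu-p10 (g6): `∃ w₀, ∀ w ≠ w₀, X_w = 0`):
* `σ` := the real place under `w₀` (★ `exists_cmPlaceOver_eq`); the doubled datum `′ = (prodUnique, dD ∘ castAdd, ⟨a′⟩)` has signature `(2, 2)` at `σ` — §1
  `card_posIdx_negIdx_of_doubled` (a doubled sign vector `(x, −x)` has `m` positive and `m` non-positive entries) gives the literal block frames
  `e₂P e₂Q : PosIdx∕NegIdx (signVec′ σ) ≃ Fin 2` (`Fintype.equivFinOfCardEq`, `n = 2` from `e : Fin 2 × Fin 1 ≃ Fin n`);
* §2 `archSkew_hermD_line_eq`: `𝔲(J^𝔻′) = 𝔲(diagonal dD)` (`J^𝔻′ = a′ • diagonal dD`), so ★ `exists_lie_expGL_eq_placeSecJ_expMem_of_single` (K2Liu-p09) charts `X` at the datum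
  `′`: `exp (tX) = placeSecJ′ σ (exp (tY), 1)` for a `Y ∈ 𝔲(2,2)`;
* ★ `archWeilRep_fst_placeSecJ_tensorPi` (this seat, the PRODUCT LAW) at `u := exp (tY)` is K2Liu-p10's `hprod` in the frame `𝒥 := R_r⁻¹ ≫ 𝒥′` (the relabelling
  `R_r` folded into the scaled frame: `𝒥.symm = R_r ∘ 𝒥′.symm` POINTWISE BY `rfl`); ★ `exists_clm_hasDerivAt_weilDatum_expMem_smul` (K2Liu-p09) at ★
  `isArchWeilDatum_weilRepPair` ∕ ★ `weilRepPair_κ_hermitePi_zero` is `hW`; ★ `contDiffAt_coe_etaD_placeSecJ_expMem` is `hη`; `hW0`, `hη0` by ★ `expMem_zero_smul`;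
  the odd unitary archimedean type of `toHeckeCharacter λ` EXISTS (★ `IsSplittingChar.exists_hasUnitaryArchType_odd`) — so NO letter is left:
* §3 **`thetaOrbitLetter_archWeilRep_line (hX) (hXD)`** = ★ p863585 `thetaOrbitLetter_of_productLaw` on these inputs: the `hWorb` binder of ★ p863031
  `faceG_thetaLetter_of_archOrbitDeriv'` VERBATIM at `N = 2`, for every single-place `X`; F1 ED. 2 ★ p863040's `hGΘ` at the `DX` of record is then
  `faceG_thetaLetter_of_archOrbitDeriv' … hX (thetaOrbitLetter_archWeilRep_line … hX hXD) Φ'`.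
HONEST LABEL.  Count-neutral helper; it retires nothing by itself: `HC_CM` is proved only modulo the 7 printed citations (2 remaining named inputs:
hLiu418 = `stmt-HodgeConjecture-24832`, h413 = `stmt-HodgeConjecture-24833`) until rung 0 closes.

References: [Folland1989] G. B. Folland, *Harmonic Analysis in Phase Space* (1989) Prop. (1.43), §1.7, §4.2 (4.23)–(4.24), Prop. (4.39); [Weil1964] A. Weil, Acta Math. 111
(1964) Chap. I n° 12, Chap. III n° 37–38; [KonnoKonno2007] Kyushu J. Math. 61 (2007) §3.1, §3.3, Lemma 5.2; [Varadarajan1984] Thm. 2.10.1, Thm. 2.11.2; [BorelJacquet1979]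
PSPM 33.1 §4.1; [Knapp2002] Introduction §2 Prop. 0.11; [ReedSimonI1980] Thm V.13; [GelbartRogawski1991] Invent. Math. 105 (1991) §3.1 Prop. 3.1.1 p. 455.
-/

set_option autoImplicit false
-- the mandated namespace repeats the single-problem summit's segment (`HodgeConjecture.HodgeConjecture`)
set_option linter.dupNamespace false
-- statements over the adelic dual-pair carriers elaborate to very large types; elaborate sequentially (as in ★ F3 ∕ ★ p863031 ∕ ★ p863615)
set_option Elab.async false

noncomputable section
open NumberField NumberField.InfinitePlace NumberField.mixedEmbedding IsDedekindDomain
open scoped Matrix TensorProduct SchwartzMap Classical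

namespace Summit.HodgeConjecture.HodgeConjecture.Cruxes.HLiu418.K2LiuFaceGThetaOrbitLetter

open Literature.NumberTheory.Automorphic Literature.NumberTheory.Automorphic.UnitaryGroup
open Literature.NumberTheory.Automorphic.IdeleClassGroup
open Literature.NumberTheory.Automorphic.Liu2021
open Literature.NumberTheory.Automorphic.Liu2021.Def411WeilCarriers
open Literature.NumberTheory.Automorphic.Liu2021.Def411WeilCarriersDoubling
open Literature.NumberTheory.GelbartRogawski1991 Literature.NumberTheory.GelbartRogawski1991.UnitaryDualPair
open Literature.NumberTheory.GelbartRogawski1991.UnitaryDualPair.LocalSplitting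
open Literature.NumberTheory.GelbartRogawski1991.GRConstruction
open Literature.NumberTheory.GaloisRepresentations
open Literature.NumberTheory.Weil1964 Literature.NumberTheory.Weil1964.MpS Literature.NumberTheory.Weil1964.UnitaryWeil
open Literature.Analysis.SegalBargmann
open Literature.RepresentationTheory.Liu2021
open Literature.RepresentationTheory.HeisenbergGroup
open Literature.RepresentationTheory.HarrisKudlaSweet1996 (IsSplittingChar)
open Literature.RepresentationTheory.KonnoKonno2007 hiding LetterKind letterOf letterGen letterOf_boost letterOf_torus letterOf_torus_eq
  letterGen_boost letterGen_torus letterGen_mem_lie exp_smul_letterGen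
open Literature.RepresentationTheory.KonnoKonno2007.RealDualPair
open Literature.NumberTheory.K2Lit.DoubledLineTheta
open Summit.HodgeConjecture.HodgeConjecture.Cruxes.HLiu418.K2LiuFaceGThetaLetter (proj_chiSplittingLine_eq_toSp archSkew_diagonal_of_hermD)
open Summit.HodgeConjecture.HodgeConjecture.Cruxes.HLiu418.K2LiuUndoublingSeesawPermutation (rowEquiv)
open Summit.HodgeConjecture.HodgeConjecture.Cruxes.HLiu418.K2LiuUndoublingSeesawPermutationMem (hermD_e₀_eq_smul_diagonal)
open Summit.HodgeConjecture.HodgeConjecture.Cruxes.HLiu418.K2LiuUndoublingSeesawLine (dD_natAdd_eq_neg prodUnique_symm_fst)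
open Summit.HodgeConjecture.HodgeConjecture.Cruxes.HLiu418.K2LiuFaceGThetaOrbitModel (arch_hermD_line_eq archWeilRep_fst_placeSecJ_tensorPi)
open Summit.HodgeConjecture.HodgeConjecture.Cruxes.HLiu418.K2LiuArchOrbitLawOfProductLaw (thetaOrbitLetter_of_productLaw)
open Summit.HodgeConjecture.HodgeConjecture.Cruxes.HLiu418.K2LiuArchSectionPlaceBlock (placeSecJ exists_lie_expGL_eq_placeSecJ_expMem_of_single)
open Summit.HodgeConjecture.HodgeConjecture.Cruxes.HLiu418.K2LiuWeilDatumSmoothU22 (exists_clm_hasDerivAt_weilDatum_expMem_smul)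
open Summit.HodgeConjecture.HodgeConjecture.Cruxes.HLiu418.K2LiuSwSectionArchOrbit (contDiffAt_coe_etaD_placeSecJ_expMem expMem_zero_smul)
open Summit.HodgeConjecture.HodgeConjecture.Cruxes.HLiu418.K2LiuArchTensorPlaceSec (exists_cmPlaceOver_eq)
open HodgeCM.Model.HypCensus (archWeilRep)

-- Mathlib idiom (`Mathlib/Algebra/Lie/OfAssociative.lean`), as in ★ (G2-W2) ∕ ★ p863434 ∕ ★ p863534: the commutator bracket on `Matrix n n ℂ`, needed to NAME the
-- Lie subalgebra `(uFormGroup (Fin 2) (Fin 2)).lie` of the chart letter `Y`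
attribute [local instance 100] LieRing.ofAssociativeRing

/-! ## §1 A doubled sign vector has as many positive as non-positive entries -/

/-- **`#PosIdx (x, −x) = #NegIdx (x, −x) = m`** for a doubled real vector with no zero entry on the first half (the involution swapping the halves exchanges
the two index types; ★ `signSplit`). [cite: KonnoKonno2007, §3.1 (3.1)] -/
theorem card_posIdx_negIdx_of_doubled {m : ℕ} (x : Fin (m + m) → ℝ)
    (hx : ∀ k, x (finSumFinEquiv (Sum.inr k)) = -x (finSumFinEquiv (Sum.inl k))) (h0 : ∀ k, x (finSumFinEquiv (Sum.inl k)) ≠ 0) :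
    Fintype.card (PosIdx x) = m ∧ Fintype.card (NegIdx x) = m := by
  have hτ : ∀ i, x ((finSumFinEquiv.symm.trans ((Equiv.sumComm (Fin m) (Fin m)).trans finSumFinEquiv)) i) = -x i := by
    intro i
    obtain ⟨s, rfl⟩ := finSumFinEquiv.surjective i
    rcases s with k | k
    · rw [Equiv.trans_apply, Equiv.trans_apply, Equiv.symm_apply_apply, Equiv.sumComm_apply, Sum.swap_inl, hx]
    · rw [Equiv.trans_apply, Equiv.trans_apply, Equiv.symm_apply_apply, Equiv.sumComm_apply, Sum.swap_inr, hx, neg_neg]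
  have hx0 : ∀ i, x i ≠ 0 := by
    intro i
    obtain ⟨s, rfl⟩ := finSumFinEquiv.surjective i
    rcases s with k | k
    · exact h0 k
    · rw [hx]; exact neg_ne_zero.2 (h0 k)
  have heq : Fintype.card (PosIdx x) = Fintype.card (NegIdx x) :=
    Fintype.card_congr ((finSumFinEquiv.symm.trans ((Equiv.sumComm (Fin m) (Fin m)).trans finSumFinEquiv)).subtypeEquiv fun i => by
      rw [hτ]
      refine ⟨fun h => not_lt.2 (neg_nonpos.2 h.le), fun h => ?_⟩
      rcases lt_or_gt_of_ne (hx0 i) with h' | h'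
      · exact absurd (neg_pos.2 h') h
      · exact h')
  have hsum : Fintype.card (PosIdx x) + Fintype.card (NegIdx x) = m + m := by
    rw [← Fintype.card_sum, ← Fintype.card_congr (signSplit x), Fintype.card_fin]
  omega

variable (L : Type) [Field L] [NumberField L] [IsCMField L]
variable {n : ℕ} (e : Fin 2 × Fin 1 ≃ Fin n)
  (dV : Fin 2 → L) (hdV : ∀ i, IsCMField.complexConj L (dV i) = dV i)
  (dW : Fin 1 → L) (hdW : ∀ i, IsCMField.complexConj L (dW i) = dW i)
  {n'' : ℕ} (e₁ : Fin (n + n) × Fin 1 ≃ Fin n'')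
  (hdV0 : ∀ i, dV i ≠ 0) (hdW0 : ∀ i, dW i ≠ 0)
  (lam : IdeleClassGroup L →ₜ* Circle) (hlam : IsConjugateSymplectic L lam) (a' : (Fp L)ˣ)

/-! ## §2 The Lie algebras of the two frames agree -/

/-- **`𝔲(J^𝔻′) = 𝔲(diagonal dD)`** inside the `2n × 2n` matrices over `L ⊗ ℝ`: `J^𝔻′ = a′ • diagonal dD` (★ `hermD_e₀_eq_smul_diagonal`) and the skew-hermitian condition is
homogeneous in the form (twin of ★ `arch_hermD_line_eq`). [cite: Knapp2002, I §1] [cite: Kudla1994, §2 (doubled space, Siegel parabolic)] -/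
theorem archSkew_hermD_line_eq :
    archSkew (Fp L) L (IsCMField.complexConj L) (n + n) (hermD L (Equiv.prodUnique (Fin n) (Fin 1)) (fun i => dD L e dV hdV dW hdW (Fin.castAdd n i)) (fun i => dD_conj L e dV hdV dW hdW (Fin.castAdd n i)) (lineW L (TW (Fp L) a')) (complexConj_lineW L (TW (Fp L) a'))) =
      archSkew (Fp L) L (IsCMField.complexConj L) (n + n) (Matrix.diagonal (dD L e dV hdV dW hdW)) := by
  ext X
  rw [mem_archSkew_iff, mem_archSkew_iff]
  unfold archFormOf
  rw [hermD_e₀_eq_smul_diagonal L (Equiv.prodUnique (Fin n) (Fin 1)) prodUnique_symm_fst (dD L e dV hdV dW hdW)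
    (dD_natAdd_eq_neg L e dV hdV dW hdW) (lineW L (TW (Fp L) a')) (complexConj_lineW L (TW (Fp L) a'))
    (fun i => dD L e dV hdV dW hdW (Fin.castAdd n i)) (fun i => dD_conj L e dV hdV dW hdW (Fin.castAdd n i)) (fun _ => rfl),
    Matrix.map_smul' _ _ _ (map_mul (mixedEmbedding L)), Matrix.mul_smul, Matrix.smul_mul, ← smul_add]
  exact ⟨fun h => (IsUnit.smul_eq_zero ((isUnit_iff_ne_zero.mpr (lineW_ne_zero L (TW (Fp L) a') (isUnit_det_TW (Fp L) a') 0)).map _)).1 h,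
    fun h => by rw [h, smul_zero]⟩

/-! ## §3 THE DEALT LETTER: (W-orb) at every single-place direction -/

include hdV0 hdW0 in
/-- **(W-orb) — EVERY `𝓢(X_∞)`-ORBIT MAP OF THE SMALL PAIR'S ARCHIMEDEAN WEIL REPRESENTATION IS WEAKLY DIFFERENTIABLE AT `t = 0` ALONG `t ↦ (exp tX, 1)`, FOR
EVERY SINGLE-PLACE `X ∈ 𝔲(J^𝔻)`** (the `hWorb` binder of ★ p863031 `faceG_thetaLetter_of_archOrbitDeriv'`, rank profile `N = 2`): ★ p863585
`thetaOrbitLetter_of_productLaw` at the frame `𝒥 := R_r⁻¹ ≫ 𝒥′` of the real place under the support of `X`, with `hprod :=` ★ `archWeilRep_fst_placeSecJ_tensorPi`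
along the chart ★ `exists_lie_expGL_eq_placeSecJ_expMem_of_single`, `hW :=` ★ `exists_clm_hasDerivAt_weilDatum_expMem_smul` at ★ `isArchWeilDatum_weilRepPair`,
`hη :=` ★ `contDiffAt_coe_etaD_placeSecJ_expMem`, `hW0 hη0 :=` ★ `expMem_zero_smul`. [cite: Folland1989, §4.2 (4.24), Prop. (4.39)] [cite: Varadarajan1984, Thm. 2.10.1]
[cite: KonnoKonno2007, §3.3, Lemma 5.2] [cite: Weil1964, Chap. III n° 37–38] [cite: ReedSimonI1980, Thm V.13] -/
theorem thetaOrbitLetter_archWeilRep_line {X : Matrix (Fin (n + n)) (Fin (n + n)) (mixedSpace L)}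
    (hX : X ∈ archSkew (Fp L) L (IsCMField.complexConj L) (n + n) (hermD L e dV hdV dW hdW))
    (hXD : ∃ w₀ : {w : InfinitePlace L // w.IsComplex}, ∀ w : {w : InfinitePlace L // w.IsComplex}, w ≠ w₀ → X.map (evalC L w) = 0) :
    ∀ Ψinf : 𝓢((Fin n'' → mixedSpace (Fp L)), ℂ), ∃ Ψinf' : 𝓢((Fin n'' → mixedSpace (Fp L)), ℂ),
      ∀ T : 𝓢((Fin n'' → mixedSpace (Fp L)), ℂ) →L[ℝ] ℂ,
      HasDerivAt (fun t : ℝ => T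
        (archWeilRep (Fp L) L (IsCMField.complexConj L) (n + n) 1 (Matrix.diagonal (dD L e dV hdV dW hdW)) (JW (Fp L) L a')
            (complexConj_imagUnit L) (imagUnit_ne_zero L) (imagUnit_mul_self L)
            (realDiagonal_isSymm L (dD L e dV hdV dW hdW) (dD_conj L e dV hdV dW hdW)) (isSymm_TW (Fp L) a')
            (isUnit_det_realDiagonal L (dD L e dV hdV dW hdW) (dD_conj L e dV hdV dW hdW) (dD_ne_zero L e dV hdV dW hdW hdV0 hdW0))
            (isUnit_det_TW (Fp L) a') (realDiagonal_map L (dD L e dV hdV dW hdW) (dD_conj L e dV hdV dW hdW)).symm (JW_eq (Fp L) L a') e₁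
            (chiSplittingLine L e₁ (dD L e dV hdV dW hdW) (dD_conj L e dV hdV dW hdW) (dD_ne_zero L e dV hdV dW hdW hdV0 hdW0)
              (toHeckeCharacter L lam) (isUnitary_toHeckeCharacter L lam)
              ((isOscillatorChar_toHeckeCharacter_iff lam).mpr hlam) (TW (Fp L) a')
              (isUnit_det_TW (Fp L) a') (JW (Fp L) L a') (JW_eq (Fp L) L a'))
            (proj_chiSplittingLine_eq_toSp L e dV hdV dW hdW e₁ hdV0 hdW0 lam hlam a') (⟨expGL (t • X), expGL_smul_mem_arch (Matrix.diagonal (dD L e dV hdV dW hdW)) (archSkew_diagonal_of_hermD L e dV hdV dW hdW hX) t⟩, 1) Ψinf))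
        (T Ψinf') 0 := by
  obtain ⟨w₀, hw₀⟩ := hXD
  obtain ⟨σ, rfl⟩ := exists_cmPlaceOver_eq L w₀
  -- the odd unitary archimedean type of `toHeckeCharacter λ`
  obtain ⟨tA, htA, hoddA⟩ := IsSplittingChar.exists_hasUnitaryArchType_odd L (isUnitary_toHeckeCharacter L lam)
    ((isOscillatorChar_toHeckeCharacter_iff lam).mpr hlam)
  -- the sign frames of the doubled datum `′` at `σ`: signature `(2, 2)`
  have hn : n = 2 := by
    have h := Fintype.card_congr e
    simp only [Fintype.card_prod, Fintype.card_fin] at h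
    omega
  have hsv : ∀ k, signVec (cmPlaceOver L) (fun k => Sum.elim (cmGramEntry L (Equiv.prodUnique (Fin n) (Fin 1)) (fun i => dD L e dV hdV dW hdW (Fin.castAdd n i)) (fun i => dD_conj L e dV hdV dW hdW (Fin.castAdd n i)) (lineW L (TW (Fp L) a')) (complexConj_lineW L (TW (Fp L) a'))) (-cmGramEntry L (Equiv.prodUnique (Fin n) (Fin 1)) (fun i => dD L e dV hdV dW hdW (Fin.castAdd n i)) (fun i => dD_conj L e dV hdV dW hdW (Fin.castAdd n i)) (lineW L (TW (Fp L) a')) (complexConj_lineW L (TW (Fp L) a'))) ((LocalSplitting.e₂ n).symm k)) (imagUnit L) σ k =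
      embedding_of_isReal σ.2 ((fun k => Sum.elim (cmGramEntry L (Equiv.prodUnique (Fin n) (Fin 1)) (fun i => dD L e dV hdV dW hdW (Fin.castAdd n i)) (fun i => dD_conj L e dV hdV dW hdW (Fin.castAdd n i)) (lineW L (TW (Fp L) a')) (complexConj_lineW L (TW (Fp L) a'))) (-cmGramEntry L (Equiv.prodUnique (Fin n) (Fin 1)) (fun i => dD L e dV hdV dW hdW (Fin.castAdd n i)) (fun i => dD_conj L e dV hdV dW hdW (Fin.castAdd n i)) (lineW L (TW (Fp L) a')) (complexConj_lineW L (TW (Fp L) a'))) ((LocalSplitting.e₂ n).symm k)) k) / deltaIm (cmPlaceOver L) (imagUnit L) σ := fun _ => rfl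
  obtain ⟨hP, hN⟩ := card_posIdx_negIdx_of_doubled (signVec (cmPlaceOver L) (fun k => Sum.elim (cmGramEntry L (Equiv.prodUnique (Fin n) (Fin 1)) (fun i => dD L e dV hdV dW hdW (Fin.castAdd n i)) (fun i => dD_conj L e dV hdV dW hdW (Fin.castAdd n i)) (lineW L (TW (Fp L) a')) (complexConj_lineW L (TW (Fp L) a'))) (-cmGramEntry L (Equiv.prodUnique (Fin n) (Fin 1)) (fun i => dD L e dV hdV dW hdW (Fin.castAdd n i)) (fun i => dD_conj L e dV hdV dW hdW (Fin.castAdd n i)) (lineW L (TW (Fp L) a')) (complexConj_lineW L (TW (Fp L) a'))) ((LocalSplitting.e₂ n).symm k)) (imagUnit L) σ)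
    (fun k => by
      rw [hsv, hsv, ← neg_div]
      refine congrArg (· / _) ?_
      simp only [LocalSplitting.e₂, Equiv.symm_apply_apply, Sum.elim_inl, Sum.elim_inr, Pi.neg_apply, map_neg])
    (fun k => by
      rw [hsv]
      simp only [LocalSplitting.e₂, Equiv.symm_apply_apply, Sum.elim_inl]
      exact div_ne_zero ((map_ne_zero _).2 (cmGramEntry_ne_zero L (Equiv.prodUnique (Fin n) (Fin 1)) (fun i => dD L e dV hdV dW hdW (Fin.castAdd n i)) (fun i => dD_conj L e dV hdV dW hdW (Fin.castAdd n i)) (lineW L (TW (Fp L) a')) (complexConj_lineW L (TW (Fp L) a')) (fun i => dD_ne_zero L e dV hdV dW hdW hdV0 hdW0 (Fin.castAdd n i)) (lineW_ne_zero L (TW (Fp L) a') (isUnit_det_TW (Fp L) a')) k))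
        (deltaIm_ne_zero (IsCMField.complexConj_ne_one L) (cmPlaceOver_smul L) (complexConj_imagUnit L) (imagUnit_ne_zero L) σ))
  obtain ⟨e₂P⟩ : Nonempty (PosIdx (signVec (cmPlaceOver L) (fun k => Sum.elim (cmGramEntry L (Equiv.prodUnique (Fin n) (Fin 1)) (fun i => dD L e dV hdV dW hdW (Fin.castAdd n i)) (fun i => dD_conj L e dV hdV dW hdW (Fin.castAdd n i)) (lineW L (TW (Fp L) a')) (complexConj_lineW L (TW (Fp L) a'))) (-cmGramEntry L (Equiv.prodUnique (Fin n) (Fin 1)) (fun i => dD L e dV hdV dW hdW (Fin.castAdd n i)) (fun i => dD_conj L e dV hdV dW hdW (Fin.castAdd n i)) (lineW L (TW (Fp L) a')) (complexConj_lineW L (TW (Fp L) a'))) ((LocalSplitting.e₂ n).symm k)) (imagUnit L) σ) ≃ Fin 2) := ⟨Fintype.equivFinOfCardEq (hP.trans hn)⟩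
  obtain ⟨e₂Q⟩ : Nonempty (NegIdx (signVec (cmPlaceOver L) (fun k => Sum.elim (cmGramEntry L (Equiv.prodUnique (Fin n) (Fin 1)) (fun i => dD L e dV hdV dW hdW (Fin.castAdd n i)) (fun i => dD_conj L e dV hdV dW hdW (Fin.castAdd n i)) (lineW L (TW (Fp L) a')) (complexConj_lineW L (TW (Fp L) a'))) (-cmGramEntry L (Equiv.prodUnique (Fin n) (Fin 1)) (fun i => dD L e dV hdV dW hdW (Fin.castAdd n i)) (fun i => dD_conj L e dV hdV dW hdW (Fin.castAdd n i)) (lineW L (TW (Fp L) a')) (complexConj_lineW L (TW (Fp L) a'))) ((LocalSplitting.e₂ n).symm k)) (imagUnit L) σ) ≃ Fin 2) := ⟨Fintype.equivFinOfCardEq (hN.trans hn)⟩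
  -- the chart of `X` at the datum `′` (★ K2Liu-p09)
  have hX' : X ∈ archSkew (Fp L) L (IsCMField.complexConj L) (n + n) (hermD L (Equiv.prodUnique (Fin n) (Fin 1)) (fun i => dD L e dV hdV dW hdW (Fin.castAdd n i)) (fun i => dD_conj L e dV hdV dW hdW (Fin.castAdd n i)) (lineW L (TW (Fp L) a')) (complexConj_lineW L (TW (Fp L) a'))) :=
    (archSkew_hermD_line_eq L e dV hdV dW hdW a').symm.le (archSkew_diagonal_of_hermD L e dV hdV dW hdW hX)
  obtain ⟨Y, hcurve⟩ := exists_lie_expGL_eq_placeSecJ_expMem_of_single L (IsCMField.complexConj L) (n + n) (IsCMField.complexConj_ne_one L) (cmPlaceOver L)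
    (cmPlaceOver_smul L) _ (gramD_gram_realDiagonal_entry_ne_zero L (Equiv.prodUnique (Fin n) (Fin 1)) (fun i => dD L e dV hdV dW hdW (Fin.castAdd n i)) (fun i => dD_conj L e dV hdV dW hdW (Fin.castAdd n i)) (lineW L (TW (Fp L) a')) (complexConj_lineW L (TW (Fp L) a')) (fun i => dD_ne_zero L e dV hdV dW hdW hdV0 hdW0 (Fin.castAdd n i)) (lineW_ne_zero L (TW (Fp L) a') (isUnit_det_TW (Fp L) a'))) (complexConj_imagUnit L) (imagUnit_ne_zero L) σ (cmPlaceOver_comap L) (gramD_eq_diagonal_cm L (Equiv.prodUnique (Fin n) (Fin 1)) (fun i => dD L e dV hdV dW hdW (Fin.castAdd n i)) (fun i => dD_conj L e dV hdV dW hdW (Fin.castAdd n i)) (lineW L (TW (Fp L) a')) (complexConj_lineW L (TW (Fp L) a')))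
    (J := hermD L (Equiv.prodUnique (Fin n) (Fin 1)) (fun i => dD L e dV hdV dW hdW (Fin.castAdd n i)) (fun i => dD_conj L e dV hdV dW hdW (Fin.castAdd n i)) (lineW L (TW (Fp L) a')) (complexConj_lineW L (TW (Fp L) a'))) rfl (complexConj_smul_infinitePlace L) e₂P e₂Q hX' hw₀
  -- (G2-W2) in operator form (★ K2Liu-p09) at the hypothesis-free junction datum
  obtain ⟨D, hD⟩ := exists_clm_hasDerivAt_weilDatum_expMem_smul (V := ℂ) (isArchWeilDatum_weilRepPair (Fin 2) (Fin 2) Unit Empty)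
    weilRepPair_κ_hermitePi_zero Y
  -- the frame `𝒥 = R_r⁻¹ ≫ 𝒥′` reads `R_r ∘ 𝒥′⁻¹` backwards, pointwise by `rfl`
  have hJ : ∀ x, ((((schwartzTransport
                  (((LinearEquiv.funCongrLeft ℝ (mixedSpace (Fp L)) (rowEquiv e₁)).toContinuousLinearEquiv).trans
                    (scaledFrame (Fp L) (Fin (n + n))
              (placeScale (n + n) fun v => sqrtAbs (signVec (cmPlaceOver L)
                (fun k => Sum.elim (cmGramEntry L (Equiv.prodUnique (Fin n) (Fin 1)) (fun i => dD L e dV hdV dW hdW (Fin.castAdd n i)) (fun i => dD_conj L e dV hdV dW hdW (Fin.castAdd n i)) (lineW L (TW (Fp L) a')) (complexConj_lineW L (TW (Fp L) a'))) (-cmGramEntry L (Equiv.prodUnique (Fin n) (Fin 1)) (fun i => dD L e dV hdV dW hdW (Fin.castAdd n i)) (fun i => dD_conj L e dV hdV dW hdW (Fin.castAdd n i)) (lineW L (TW (Fp L) a')) (complexConj_lineW L (TW (Fp L) a'))) ((LocalSplitting.e₂ n).symm k))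
                (imagUnit L) v))
              (placeScale_ne_zero (n + n) (sqrtAbs_signVec_ne_zero (IsCMField.complexConj_ne_one L) (cmPlaceOver_smul L)
                (complexConj_imagUnit L) (imagUnit_ne_zero L) (gramD_gram_realDiagonal_entry_ne_zero L (Equiv.prodUnique (Fin n) (Fin 1)) (fun i => dD L e dV hdV dW hdW (Fin.castAdd n i)) (fun i => dD_conj L e dV hdV dW hdW (Fin.castAdd n i)) (lineW L (TW (Fp L) a')) (complexConj_lineW L (TW (Fp L) a')) (fun i => dD_ne_zero L e dV hdV dW hdW hdV0 hdW0 (Fin.castAdd n i)) (lineW_ne_zero L (TW (Fp L) a') (isUnit_det_TW (Fp L) a')))))))).trans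
                (schwartzTransport (reindexCLE (placeSplitEquiv (signSplit (signVec (cmPlaceOver L) (fun k => Sum.elim (cmGramEntry L (Equiv.prodUnique (Fin n) (Fin 1)) (fun i => dD L e dV hdV dW hdW (Fin.castAdd n i)) (fun i => dD_conj L e dV hdV dW hdW (Fin.castAdd n i)) (lineW L (TW (Fp L) a')) (complexConj_lineW L (TW (Fp L) a'))) (-cmGramEntry L (Equiv.prodUnique (Fin n) (Fin 1)) (fun i => dD L e dV hdV dW hdW (Fin.castAdd n i)) (fun i => dD_conj L e dV hdV dW hdW (Fin.castAdd n i)) (lineW L (TW (Fp L) a')) (complexConj_lineW L (TW (Fp L) a'))) ((LocalSplitting.e₂ n).symm k)) (imagUnit L) σ)) σ)))).trans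
                (schwartzTransport (reindexCLE (Equiv.sumCongr (unitJunctionIdx (PosIdx (signVec (cmPlaceOver L) (fun k => Sum.elim (cmGramEntry L (Equiv.prodUnique (Fin n) (Fin 1)) (fun i => dD L e dV hdV dW hdW (Fin.castAdd n i)) (fun i => dD_conj L e dV hdV dW hdW (Fin.castAdd n i)) (lineW L (TW (Fp L) a')) (complexConj_lineW L (TW (Fp L) a'))) (-cmGramEntry L (Equiv.prodUnique (Fin n) (Fin 1)) (fun i => dD L e dV hdV dW hdW (Fin.castAdd n i)) (fun i => dD_conj L e dV hdV dW hdW (Fin.castAdd n i)) (lineW L (TW (Fp L) a')) (complexConj_lineW L (TW (Fp L) a'))) ((LocalSplitting.e₂ n).symm k)) (imagUnit L) σ)) (NegIdx (signVec (cmPlaceOver L) (fun k => Sum.elim (cmGramEntry L (Equiv.prodUnique (Fin n) (Fin 1)) (fun i => dD L e dV hdV dW hdW (Fin.castAdd n i)) (fun i => dD_conj L e dV hdV dW hdW (Fin.castAdd n i)) (lineW L (TW (Fp L) a')) (complexConj_lineW L (TW (Fp L) a'))) (-cmGramEntry L (Equiv.prodUnique (Fin n) (Fin 1)) (fun i =>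 dD L e dV hdV dW hdW (Fin.castAdd n i)) (fun i => dD_conj L e dV hdV dW hdW (Fin.castAdd n i)) (lineW L (TW (Fp L) a')) (complexConj_lineW L (TW (Fp L) a'))) ((LocalSplitting.e₂ n).symm k)) (imagUnit L) σ))).symm
                  (Equiv.refl (Fin (n + n) × {v : {v : InfinitePlace (Fp L) // v.IsReal} // v ≠ σ})))))).trans
                (schwartzTransport (reindexCLE (Equiv.sumCongr
                  (dpIdxCongr (PosIdx (signVec (cmPlaceOver L) (fun k => Sum.elim (cmGramEntry L (Equiv.prodUnique (Fin n) (Fin 1)) (fun i => dD L e dV hdV dW hdW (Fin.castAdd n i)) (fun i => dD_conj L e dV hdV dW hdW (Fin.castAdd n i)) (lineW L (TW (Fp L) a')) (complexConj_lineW L (TW (Fp L) a'))) (-cmGramEntry L (Equiv.prodUnique (Fin n) (Fin 1)) (fun i => dD L e dV hdV dW hdW (Fin.castAdd n i)) (fun i => dD_conj L e dV hdV dW hdW (Fin.castAdd n i)) (lineW L (TW (Fp L) a')) (complexConj_lineW L (TW (Fp L) a'))) ((LocalSplitting.e₂ n).symm k)) (imagUnit L) σ)) (NegIdx (signVec (cmPlaceOver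 L) (fun k => Sum.elim (cmGramEntry L (Equiv.prodUnique (Fin n) (Fin 1)) (fun i => dD L e dV hdV dW hdW (Fin.castAdd n i)) (fun i => dD_conj L e dV hdV dW hdW (Fin.castAdd n i)) (lineW L (TW (Fp L) a')) (complexConj_lineW L (TW (Fp L) a'))) (-cmGramEntry L (Equiv.prodUnique (Fin n) (Fin 1)) (fun i => dD L e dV hdV dW hdW (Fin.castAdd n i)) (fun i => dD_conj L e dV hdV dW hdW (Fin.castAdd n i)) (lineW L (TW (Fp L) a')) (complexConj_lineW L (TW (Fp L) a'))) ((LocalSplitting.e₂ n).symm k)) (imagUnit L) σ)) Unit Empty (Fin 2) (Fin 2) Unit Empty e₂P e₂Q (Equiv.refl Unit) (Equiv.refl Empty)).symm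
                  (Equiv.refl (Fin (n + n) × {v : {v : InfinitePlace (Fp L) // v.IsReal} // v ≠ σ})))))).symm x =
      schwartzReindexCLM (Fp L) (rowEquiv e₁) (((((schwartzTransport
                  (scaledFrame (Fp L) (Fin (n + n))
              (placeScale (n + n) fun v => sqrtAbs (signVec (cmPlaceOver L)
                (fun k => Sum.elim (cmGramEntry L (Equiv.prodUnique (Fin n) (Fin 1)) (fun i => dD L e dV hdV dW hdW (Fin.castAdd n i)) (fun i => dD_conj L e dV hdV dW hdW (Fin.castAdd n i)) (lineW L (TW (Fp L) a')) (complexConj_lineW L (TW (Fp L) a'))) (-cmGramEntry L (Equiv.prodUnique (Fin n) (Fin 1)) (fun i => dD L e dV hdV dW hdW (Fin.castAdd n i)) (fun i => dD_conj L e dV hdV dW hdW (Fin.castAdd n i)) (lineW L (TW (Fp L) a')) (complexConj_lineW L (TW (Fp L) a'))) ((LocalSplitting.e₂ n).symm k))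
                (imagUnit L) v))
              (placeScale_ne_zero (n + n) (sqrtAbs_signVec_ne_zero (IsCMField.complexConj_ne_one L) (cmPlaceOver_smul L)
                (complexConj_imagUnit L) (imagUnit_ne_zero L) (gramD_gram_realDiagonal_entry_ne_zero L (Equiv.prodUnique (Fin n) (Fin 1)) (fun i => dD L e dV hdV dW hdW (Fin.castAdd n i)) (fun i => dD_conj L e dV hdV dW hdW (Fin.castAdd n i)) (lineW L (TW (Fp L) a')) (complexConj_lineW L (TW (Fp L) a')) (fun i => dD_ne_zero L e dV hdV dW hdW hdV0 hdW0 (Fin.castAdd n i)) (lineW_ne_zero L (TW (Fp L) a') (isUnit_det_TW (Fp L) a'))))))).trans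
                (schwartzTransport (reindexCLE (placeSplitEquiv (signSplit (signVec (cmPlaceOver L) (fun k => Sum.elim (cmGramEntry L (Equiv.prodUnique (Fin n) (Fin 1)) (fun i => dD L e dV hdV dW hdW (Fin.castAdd n i)) (fun i => dD_conj L e dV hdV dW hdW (Fin.castAdd n i)) (lineW L (TW (Fp L) a')) (complexConj_lineW L (TW (Fp L) a'))) (-cmGramEntry L (Equiv.prodUnique (Fin n) (Fin 1)) (fun i => dD L e dV hdV dW hdW (Fin.castAdd n i)) (fun i => dD_conj L e dV hdV dW hdW (Fin.castAdd n i)) (lineW L (TW (Fp L) a')) (complexConj_lineW L (TW (Fp L) a'))) ((LocalSplitting.e₂ n).symm k)) (imagUnit L) σ)) σ)))).trans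
                (schwartzTransport (reindexCLE (Equiv.sumCongr (unitJunctionIdx (PosIdx (signVec (cmPlaceOver L) (fun k => Sum.elim (cmGramEntry L (Equiv.prodUnique (Fin n) (Fin 1)) (fun i => dD L e dV hdV dW hdW (Fin.castAdd n i)) (fun i => dD_conj L e dV hdV dW hdW (Fin.castAdd n i)) (lineW L (TW (Fp L) a')) (complexConj_lineW L (TW (Fp L) a'))) (-cmGramEntry L (Equiv.prodUnique (Fin n) (Fin 1)) (fun i => dD L e dV hdV dW hdW (Fin.castAdd n i)) (fun i => dD_conj L e dV hdV dW hdW (Fin.castAdd n i)) (lineW L (TW (Fp L) a')) (complexConj_lineW L (TW (Fp L) a'))) ((LocalSplitting.e₂ n).symm k)) (imagUnit L) σ)) (NegIdx (signVec (cmPlaceOver L) (fun k => Sum.elim (cmGramEntry L (Equiv.prodUnique (Fin n) (Fin 1)) (fun i => dD L e dV hdV dW hdW (Fin.castAdd n i)) (fun i => dD_conj L e dV hdV dW hdW (Fin.castAdd n i)) (lineW L (TW (Fp L) a')) (complexConj_lineW L (TW (Fp L) a'))) (-cmGramEntry L (Equiv.prodUnique (Fin n) (Fin 1)) (fun i =>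 dD L e dV hdV dW hdW (Fin.castAdd n i)) (fun i => dD_conj L e dV hdV dW hdW (Fin.castAdd n i)) (lineW L (TW (Fp L) a')) (complexConj_lineW L (TW (Fp L) a'))) ((LocalSplitting.e₂ n).symm k)) (imagUnit L) σ))).symm
                  (Equiv.refl (Fin (n + n) × {v : {v : InfinitePlace (Fp L) // v.IsReal} // v ≠ σ})))))).trans
                (schwartzTransport (reindexCLE (Equiv.sumCongr
                  (dpIdxCongr (PosIdx (signVec (cmPlaceOver L) (fun k => Sum.elim (cmGramEntry L (Equiv.prodUnique (Fin n) (Fin 1)) (fun i => dD L e dV hdV dW hdW (Fin.castAdd n i)) (fun i => dD_conj L e dV hdV dW hdW (Fin.castAdd n i)) (lineW L (TW (Fp L) a')) (complexConj_lineW L (TW (Fp L) a'))) (-cmGramEntry L (Equiv.prodUnique (Fin n) (Fin 1)) (fun i => dD L e dV hdV dW hdW (Fin.castAdd n i)) (fun i => dD_conj L e dV hdV dW hdW (Fin.castAdd n i)) (lineW L (TW (Fp L) a')) (complexConj_lineW L (TW (Fp L) a'))) ((LocalSplitting.e₂ n).symm k)) (imagUnit L) σ)) (NegIdx (signVec (cmPlaceOver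 L) (fun k => Sum.elim (cmGramEntry L (Equiv.prodUnique (Fin n) (Fin 1)) (fun i => dD L e dV hdV dW hdW (Fin.castAdd n i)) (fun i => dD_conj L e dV hdV dW hdW (Fin.castAdd n i)) (lineW L (TW (Fp L) a')) (complexConj_lineW L (TW (Fp L) a'))) (-cmGramEntry L (Equiv.prodUnique (Fin n) (Fin 1)) (fun i => dD L e dV hdV dW hdW (Fin.castAdd n i)) (fun i => dD_conj L e dV hdV dW hdW (Fin.castAdd n i)) (lineW L (TW (Fp L) a')) (complexConj_lineW L (TW (Fp L) a'))) ((LocalSplitting.e₂ n).symm k)) (imagUnit L) σ)) Unit Empty (Fin 2) (Fin 2) Unit Empty e₂P e₂Q (Equiv.refl Unit) (Equiv.refl Empty)).symm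
                  (Equiv.refl (Fin (n + n) × {v : {v : InfinitePlace (Fp L) // v.IsReal} // v ≠ σ})))))).symm x) := fun x => by
    ext w
    rfl
  -- the determinant character along the chart is `C^∞` (★ K2Liu-p05), hence differentiable at `0`
  have hη := ((contDiffAt_coe_etaD_placeSecJ_expMem L (Equiv.prodUnique (Fin n) (Fin 1)) (fun i => dD L e dV hdV dW hdW (Fin.castAdd n i)) (fun i => dD_conj L e dV hdV dW hdW (Fin.castAdd n i)) (fun i => dD_ne_zero L e dV hdV dW hdW hdV0 hdW0 (Fin.castAdd n i)) (lineW L (TW (Fp L) a')) (complexConj_lineW L (TW (Fp L) a')) (lineW_ne_zero L (TW (Fp L) a') (isUnit_det_TW (Fp L) a')) σ e₂P e₂Q tA Y 0).differentiableAt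
    (by simp)).hasDerivAt
  -- ★ K2Liu-p10's head on these inputs
  refine thetaOrbitLetter_of_productLaw L e dV hdV dW hdW e₁ hdV0 hdW0 lam hlam a' hX
    ((((schwartzTransport
                  (((LinearEquiv.funCongrLeft ℝ (mixedSpace (Fp L)) (rowEquiv e₁)).toContinuousLinearEquiv).trans
                    (scaledFrame (Fp L) (Fin (n + n))
              (placeScale (n + n) fun v => sqrtAbs (signVec (cmPlaceOver L)
                (fun k => Sum.elim (cmGramEntry L (Equiv.prodUnique (Fin n) (Fin 1)) (fun i => dD L e dV hdV dW hdW (Fin.castAdd n i)) (fun i => dD_conj L e dV hdV dW hdW (Fin.castAdd n i)) (lineW L (TW (Fp L) a')) (complexConj_lineW L (TW (Fp L) a'))) (-cmGramEntry L (Equiv.prodUnique (Fin n) (Fin 1)) (fun i => dD L e dV hdV dW hdW (Fin.castAdd n i)) (fun i => dD_conj L e dV hdV dW hdW (Fin.castAdd n i)) (lineW L (TW (Fp L) a')) (complexConj_lineW L (TW (Fp L) a'))) ((LocalSplitting.e₂ n).symm k))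
                (imagUnit L) v))
              (placeScale_ne_zero (n + n) (sqrtAbs_signVec_ne_zero (IsCMField.complexConj_ne_one L) (cmPlaceOver_smul L)
                (complexConj_imagUnit L) (imagUnit_ne_zero L) (gramD_gram_realDiagonal_entry_ne_zero L (Equiv.prodUnique (Fin n) (Fin 1)) (fun i => dD L e dV hdV dW hdW (Fin.castAdd n i)) (fun i => dD_conj L e dV hdV dW hdW (Fin.castAdd n i)) (lineW L (TW (Fp L) a')) (complexConj_lineW L (TW (Fp L) a')) (fun i => dD_ne_zero L e dV hdV dW hdW hdV0 hdW0 (Fin.castAdd n i)) (lineW_ne_zero L (TW (Fp L) a') (isUnit_det_TW (Fp L) a')))))))).trans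
                (schwartzTransport (reindexCLE (placeSplitEquiv (signSplit (signVec (cmPlaceOver L) (fun k => Sum.elim (cmGramEntry L (Equiv.prodUnique (Fin n) (Fin 1)) (fun i => dD L e dV hdV dW hdW (Fin.castAdd n i)) (fun i => dD_conj L e dV hdV dW hdW (Fin.castAdd n i)) (lineW L (TW (Fp L) a')) (complexConj_lineW L (TW (Fp L) a'))) (-cmGramEntry L (Equiv.prodUnique (Fin n) (Fin 1)) (fun i => dD L e dV hdV dW hdW (Fin.castAdd n i)) (fun i => dD_conj L e dV hdV dW hdW (Fin.castAdd n i)) (lineW L (TW (Fp L) a')) (complexConj_lineW L (TW (Fp L) a'))) ((LocalSplitting.e₂ n).symm k)) (imagUnit L) σ)) σ)))).trans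
                (schwartzTransport (reindexCLE (Equiv.sumCongr (unitJunctionIdx (PosIdx (signVec (cmPlaceOver L) (fun k => Sum.elim (cmGramEntry L (Equiv.prodUnique (Fin n) (Fin 1)) (fun i => dD L e dV hdV dW hdW (Fin.castAdd n i)) (fun i => dD_conj L e dV hdV dW hdW (Fin.castAdd n i)) (lineW L (TW (Fp L) a')) (complexConj_lineW L (TW (Fp L) a'))) (-cmGramEntry L (Equiv.prodUnique (Fin n) (Fin 1)) (fun i => dD L e dV hdV dW hdW (Fin.castAdd n i)) (fun i => dD_conj L e dV hdV dW hdW (Fin.castAdd n i)) (lineW L (TW (Fp L) a')) (complexConj_lineW L (TW (Fp L) a'))) ((LocalSplitting.e₂ n).symm k)) (imagUnit L) σ)) (NegIdx (signVec (cmPlaceOver L) (fun k => Sum.elim (cmGramEntry L (Equiv.prodUnique (Fin n) (Fin 1)) (fun i => dD L e dV hdV dW hdW (Fin.castAdd n i)) (fun i => dD_conj L e dV hdV dW hdW (Fin.castAdd n i)) (lineW L (TW (Fp L) a')) (complexConj_lineW L (TW (Fp L) a'))) (-cmGramEntry L (Equiv.prodUnique (Fin n) (Fin 1)) (fun i =>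 dD L e dV hdV dW hdW (Fin.castAdd n i)) (fun i => dD_conj L e dV hdV dW hdW (Fin.castAdd n i)) (lineW L (TW (Fp L) a')) (complexConj_lineW L (TW (Fp L) a'))) ((LocalSplitting.e₂ n).symm k)) (imagUnit L) σ))).symm
                  (Equiv.refl (Fin (n + n) × {v : {v : InfinitePlace (Fp L) // v.IsReal} // v ≠ σ})))))).trans
                (schwartzTransport (reindexCLE (Equiv.sumCongr
                  (dpIdxCongr (PosIdx (signVec (cmPlaceOver L) (fun k => Sum.elim (cmGramEntry L (Equiv.prodUnique (Fin n) (Fin 1)) (fun i => dD L e dV hdV dW hdW (Fin.castAdd n i)) (fun i => dD_conj L e dV hdV dW hdW (Fin.castAdd n i)) (lineW L (TW (Fp L) a')) (complexConj_lineW L (TW (Fp L) a'))) (-cmGramEntry L (Equiv.prodUnique (Fin n) (Fin 1)) (fun i => dD L e dV hdV dW hdW (Fin.castAdd n i)) (fun i => dD_conj L e dV hdV dW hdW (Fin.castAdd n i)) (lineW L (TW (Fp L) a')) (complexConj_lineW L (TW (Fp L) a'))) ((LocalSplitting.e₂ n).symm k)) (imagUnit L) σ)) (NegIdx (signVec (cmPlaceOver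 L) (fun k => Sum.elim (cmGramEntry L (Equiv.prodUnique (Fin n) (Fin 1)) (fun i => dD L e dV hdV dW hdW (Fin.castAdd n i)) (fun i => dD_conj L e dV hdV dW hdW (Fin.castAdd n i)) (lineW L (TW (Fp L) a')) (complexConj_lineW L (TW (Fp L) a'))) (-cmGramEntry L (Equiv.prodUnique (Fin n) (Fin 1)) (fun i => dD L e dV hdV dW hdW (Fin.castAdd n i)) (fun i => dD_conj L e dV hdV dW hdW (Fin.castAdd n i)) (lineW L (TW (Fp L) a')) (complexConj_lineW L (TW (Fp L) a'))) ((LocalSplitting.e₂ n).symm k)) (imagUnit L) σ)) Unit Empty (Fin 2) (Fin 2) Unit Empty e₂P e₂Q (Equiv.refl Unit) (Equiv.refl Empty)).symm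
                  (Equiv.refl (Fin (n + n) × {v : {v : InfinitePlace (Fp L) // v.IsReal} // v ≠ σ}))))))
    (fun t Φ₁ => ((weilRep (α := (Fin 2 × Unit) ⊕ (Fin 2 × Empty)) (β := (Fin 2 × Empty) ⊕ (Fin 2 × Unit))).comp (toBig (Fin 2) (Fin 2) Unit Empty))
      ((((uFormGroup (Fin 2) (Fin 2)).expMem
                ⟨((t • Y : ↥(uFormGroup (Fin 2) (Fin 2)).lie.toSubmodule) : Matrix (Fin 2 ⊕ Fin 2) (Fin 2 ⊕ Fin 2) ℂ), (t • Y).2⟩ :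
                UForm (Fin 2) (Fin 2)), (1 : UForm Unit Empty)) : Ginf (Fin 2) (Fin 2) Unit Empty) Φ₁)
    D
    (fun t => ((etaD L (Equiv.prodUnique (Fin n) (Fin 1)) (fun i => dD L e dV hdV dW hdW (Fin.castAdd n i)) (fun i => dD_conj L e dV hdV dW hdW (Fin.castAdd n i)) (lineW L (TW (Fp L) a')) (complexConj_lineW L (TW (Fp L) a')) tA
      (placeSecJ L (IsCMField.complexConj L) (n + n) (IsCMField.complexConj_ne_one L) (cmPlaceOver L) (cmPlaceOver_smul L) _
              (gramD_gram_realDiagonal_entry_ne_zero L (Equiv.prodUnique (Fin n) (Fin 1)) (fun i => dD L e dV hdV dW hdW (Fin.castAdd n i)) (fun i => dD_conj L e dV hdV dW hdW (Fin.castAdd n i)) (lineW L (TW (Fp L) a')) (complexConj_lineW L (TW (Fp L) a')) (fun i => dD_ne_zero L e dV hdV dW hdW hdV0 hdW0 (Fin.castAdd n i)) (lineW_ne_zero L (TW (Fp L) a') (isUnit_det_TW (Fp L) a'))) (complexConj_imagUnit L) (imagUnit_ne_zero L) σ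
              (cmPlaceOver_comap L) (gramD_eq_diagonal_cm L (Equiv.prodUnique (Fin n) (Fin 1)) (fun i => dD L e dV hdV dW hdW (Fin.castAdd n i)) (fun i => dD_conj L e dV hdV dW hdW (Fin.castAdd n i)) (lineW L (TW (Fp L) a')) (complexConj_lineW L (TW (Fp L) a'))) (J := hermD L (Equiv.prodUnique (Fin n) (Fin 1)) (fun i => dD L e dV hdV dW hdW (Fin.castAdd n i)) (fun i => dD_conj L e dV hdV dW hdW (Fin.castAdd n i)) (lineW L (TW (Fp L) a')) (complexConj_lineW L (TW (Fp L) a'))) rfl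
              (complexConj_smul_infinitePlace L) e₂P e₂Q ((((uFormGroup (Fin 2) (Fin 2)).expMem
                ⟨((t • Y : ↥(uFormGroup (Fin 2) (Fin 2)).lie.toSubmodule) : Matrix (Fin 2 ⊕ Fin 2) (Fin 2 ⊕ Fin 2) ℂ), (t • Y).2⟩ :
                UForm (Fin 2) (Fin 2)), (1 : UForm Unit Empty)) : Ginf (Fin 2) (Fin 2) Unit Empty)) : ℂˣ) : ℂ))
    _ (fun t Φ₁ Φ₂ => ?_) (fun Φ₁ T₁ => hD T₁ Φ₁) (fun Φ₁ => ?_) hη ?_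
  · -- `hprod`: the element `(exp tX, 1)` is `(placeSecJ′ σ (exp tY, 1), 1)` (the chart), and ★ `archWeilRep_fst_placeSecJ_tensorPi`
    have hel : (⟨expGL (t • X), expGL_smul_mem_arch (Matrix.diagonal (dD L e dV hdV dW hdW)) (archSkew_diagonal_of_hermD L e dV hdV dW hdW hX) t⟩ :
          ↥(UnitaryGroup.arch (Fp L) L (IsCMField.complexConj L) (n + n) (Matrix.diagonal (dD L e dV hdV dW hdW)))) =
        ⟨(((placeSecJ L (IsCMField.complexConj L) (n + n) (IsCMField.complexConj_ne_one L) (cmPlaceOver L) (cmPlaceOver_smul L) _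
              (gramD_gram_realDiagonal_entry_ne_zero L (Equiv.prodUnique (Fin n) (Fin 1)) (fun i => dD L e dV hdV dW hdW (Fin.castAdd n i)) (fun i => dD_conj L e dV hdV dW hdW (Fin.castAdd n i)) (lineW L (TW (Fp L) a')) (complexConj_lineW L (TW (Fp L) a')) (fun i => dD_ne_zero L e dV hdV dW hdW hdV0 hdW0 (Fin.castAdd n i)) (lineW_ne_zero L (TW (Fp L) a') (isUnit_det_TW (Fp L) a'))) (complexConj_imagUnit L) (imagUnit_ne_zero L) σ
              (cmPlaceOver_comap L) (gramD_eq_diagonal_cm L (Equiv.prodUnique (Fin n) (Fin 1)) (fun i => dD L e dV hdV dW hdW (Fin.castAdd n i)) (fun i => dD_conj L e dV hdV dW hdW (Fin.castAdd n i)) (lineW L (TW (Fp L) a')) (complexConj_lineW L (TW (Fp L) a'))) (J := hermD L (Equiv.prodUnique (Fin n) (Fin 1)) (fun i => dD L e dV hdV dW hdW (Fin.castAdd n i)) (fun i => dD_conj L e dV hdV dW hdW (Fin.castAdd n i)) (lineW L (TW (Fp L) a')) (complexConj_lineW L (TW (Fp L) a'))) rfl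
              (complexConj_smul_infinitePlace L) e₂P e₂Q ((((uFormGroup (Fin 2) (Fin 2)).expMem
                ⟨((t • Y : ↥(uFormGroup (Fin 2) (Fin 2)).lie.toSubmodule) : Matrix (Fin 2 ⊕ Fin 2) (Fin 2 ⊕ Fin 2) ℂ), (t • Y).2⟩ :
                UForm (Fin 2) (Fin 2)), (1 : UForm Unit Empty)) : Ginf (Fin 2) (Fin 2) Unit Empty)) :
            ↥(UnitaryGroup.arch (Fp L) L (IsCMField.complexConj L) (n + n) (hermD L (Equiv.prodUnique (Fin n) (Fin 1)) (fun i => dD L e dV hdV dW hdW (Fin.castAdd n i)) (fun i => dD_conj L e dV hdV dW hdW (Fin.castAdd n i)) (lineW L (TW (Fp L) a')) (complexConj_lineW L (TW (Fp L) a'))))) : GL (Fin (n + n)) (mixedSpace L)),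
          (arch_hermD_line_eq L e dV hdV dW hdW a').le
            (placeSecJ L (IsCMField.complexConj L) (n + n) (IsCMField.complexConj_ne_one L) (cmPlaceOver L) (cmPlaceOver_smul L) _
              (gramD_gram_realDiagonal_entry_ne_zero L (Equiv.prodUnique (Fin n) (Fin 1)) (fun i => dD L e dV hdV dW hdW (Fin.castAdd n i)) (fun i => dD_conj L e dV hdV dW hdW (Fin.castAdd n i)) (lineW L (TW (Fp L) a')) (complexConj_lineW L (TW (Fp L) a')) (fun i => dD_ne_zero L e dV hdV dW hdW hdV0 hdW0 (Fin.castAdd n i)) (lineW_ne_zero L (TW (Fp L) a') (isUnit_det_TW (Fp L) a'))) (complexConj_imagUnit L) (imagUnit_ne_zero L) σ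
              (cmPlaceOver_comap L) (gramD_eq_diagonal_cm L (Equiv.prodUnique (Fin n) (Fin 1)) (fun i => dD L e dV hdV dW hdW (Fin.castAdd n i)) (fun i => dD_conj L e dV hdV dW hdW (Fin.castAdd n i)) (lineW L (TW (Fp L) a')) (complexConj_lineW L (TW (Fp L) a'))) (J := hermD L (Equiv.prodUnique (Fin n) (Fin 1)) (fun i => dD L e dV hdV dW hdW (Fin.castAdd n i)) (fun i => dD_conj L e dV hdV dW hdW (Fin.castAdd n i)) (lineW L (TW (Fp L) a')) (complexConj_lineW L (TW (Fp L) a'))) rfl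
              (complexConj_smul_infinitePlace L) e₂P e₂Q ((((uFormGroup (Fin 2) (Fin 2)).expMem
                ⟨((t • Y : ↥(uFormGroup (Fin 2) (Fin 2)).lie.toSubmodule) : Matrix (Fin 2 ⊕ Fin 2) (Fin 2 ⊕ Fin 2) ℂ), (t • Y).2⟩ :
                UForm (Fin 2) (Fin 2)), (1 : UForm Unit Empty)) : Ginf (Fin 2) (Fin 2) Unit Empty)).2⟩ :=
      Subtype.ext (show expGL (t • X) = _ from congrArg Subtype.val (hcurve t))
    exact ((congrArg (fun v => archWeilRep (Fp L) L (IsCMField.complexConj L) (n + n) 1 (Matrix.diagonal (dD L e dV hdV dW hdW)) (JW (Fp L) L a')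
            (complexConj_imagUnit L) (imagUnit_ne_zero L) (imagUnit_mul_self L)
            (realDiagonal_isSymm L (dD L e dV hdV dW hdW) (dD_conj L e dV hdV dW hdW)) (isSymm_TW (Fp L) a')
            (isUnit_det_realDiagonal L (dD L e dV hdV dW hdW) (dD_conj L e dV hdV dW hdW) (dD_ne_zero L e dV hdV dW hdW hdV0 hdW0))
            (isUnit_det_TW (Fp L) a') (realDiagonal_map L (dD L e dV hdV dW hdW) (dD_conj L e dV hdV dW hdW)).symm (JW_eq (Fp L) L a') e₁
            (chiSplittingLine L e₁ (dD L e dV hdV dW hdW) (dD_conj L e dV hdV dW hdW) (dD_ne_zero L e dV hdV dW hdW hdV0 hdW0)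
              (toHeckeCharacter L lam) (isUnitary_toHeckeCharacter L lam)
              ((isOscillatorChar_toHeckeCharacter_iff lam).mpr hlam) (TW (Fp L) a')
              (isUnit_det_TW (Fp L) a') (JW (Fp L) L a') (JW_eq (Fp L) L a'))
            (proj_chiSplittingLine_eq_toSp L e dV hdV dW hdW e₁ hdV0 hdW0 lam hlam a') (⟨expGL (t • X), expGL_smul_mem_arch (Matrix.diagonal (dD L e dV hdV dW hdW)) (archSkew_diagonal_of_hermD L e dV hdV dW hdW hX) t⟩, 1) v) (hJ _)).trans
      (((congrArg (fun g => archWeilRep (Fp L) L (IsCMField.complexConj L) (n + n) 1 (Matrix.diagonal (dD L e dV hdV dW hdW)) (JW (Fp L) L a')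
            (complexConj_imagUnit L) (imagUnit_ne_zero L) (imagUnit_mul_self L)
            (realDiagonal_isSymm L (dD L e dV hdV dW hdW) (dD_conj L e dV hdV dW hdW)) (isSymm_TW (Fp L) a')
            (isUnit_det_realDiagonal L (dD L e dV hdV dW hdW) (dD_conj L e dV hdV dW hdW) (dD_ne_zero L e dV hdV dW hdW hdV0 hdW0))
            (isUnit_det_TW (Fp L) a') (realDiagonal_map L (dD L e dV hdV dW hdW) (dD_conj L e dV hdV dW hdW)).symm (JW_eq (Fp L) L a') e₁
            (chiSplittingLine L e₁ (dD L e dV hdV dW hdW) (dD_conj L e dV hdV dW hdW) (dD_ne_zero L e dV hdV dW hdW hdV0 hdW0)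
              (toHeckeCharacter L lam) (isUnitary_toHeckeCharacter L lam)
              ((isOscillatorChar_toHeckeCharacter_iff lam).mpr hlam) (TW (Fp L) a')
              (isUnit_det_TW (Fp L) a') (JW (Fp L) L a') (JW_eq (Fp L) L a'))
            (proj_chiSplittingLine_eq_toSp L e dV hdV dW hdW e₁ hdV0 hdW0 lam hlam a') (g, 1) (schwartzReindexCLM (Fp L) (rowEquiv e₁) (((((schwartzTransport
                  (scaledFrame (Fp L) (Fin (n + n))
              (placeScale (n + n) fun v => sqrtAbs (signVec (cmPlaceOver L)
                (fun k => Sum.elim (cmGramEntry L (Equiv.prodUnique (Fin n) (Fin 1)) (fun i => dD L e dV hdV dW hdW (Fin.castAdd n i)) (fun i => dD_conj L e dV hdV dW hdW (Fin.castAdd n i)) (lineW L (TW (Fp L) a')) (complexConj_lineW L (TW (Fp L) a'))) (-cmGramEntry L (Equiv.prodUnique (Fin n) (Fin 1)) (fun i => dD L e dV hdV dW hdW (Fin.castAdd n i)) (fun i => dD_conj L e dV hdV dW hdW (Fin.castAdd n i)) (lineW L (TW (Fp L) a')) (complexConj_lineW L (TW (Fp L) a'))) ((LocalSplitting.e₂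 n).symm k))
                (imagUnit L) v))
              (placeScale_ne_zero (n + n) (sqrtAbs_signVec_ne_zero (IsCMField.complexConj_ne_one L) (cmPlaceOver_smul L)
                (complexConj_imagUnit L) (imagUnit_ne_zero L) (gramD_gram_realDiagonal_entry_ne_zero L (Equiv.prodUnique (Fin n) (Fin 1)) (fun i => dD L e dV hdV dW hdW (Fin.castAdd n i)) (fun i => dD_conj L e dV hdV dW hdW (Fin.castAdd n i)) (lineW L (TW (Fp L) a')) (complexConj_lineW L (TW (Fp L) a')) (fun i => dD_ne_zero L e dV hdV dW hdW hdV0 hdW0 (Fin.castAdd n i)) (lineW_ne_zero L (TW (Fp L) a') (isUnit_det_TW (Fp L) a'))))))).trans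
                (schwartzTransport (reindexCLE (placeSplitEquiv (signSplit (signVec (cmPlaceOver L) (fun k => Sum.elim (cmGramEntry L (Equiv.prodUnique (Fin n) (Fin 1)) (fun i => dD L e dV hdV dW hdW (Fin.castAdd n i)) (fun i => dD_conj L e dV hdV dW hdW (Fin.castAdd n i)) (lineW L (TW (Fp L) a')) (complexConj_lineW L (TW (Fp L) a'))) (-cmGramEntry L (Equiv.prodUnique (Fin n) (Fin 1)) (fun i => dD L e dV hdV dW hdW (Fin.castAdd n i)) (fun i => dD_conj L e dV hdV dW hdW (Fin.castAdd n i)) (lineW L (TW (Fp L) a')) (complexConj_lineW L (TW (Fp L) a'))) ((LocalSplitting.e₂ n).symm k)) (imagUnit L) σ)) σ)))).trans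
                (schwartzTransport (reindexCLE (Equiv.sumCongr (unitJunctionIdx (PosIdx (signVec (cmPlaceOver L) (fun k => Sum.elim (cmGramEntry L (Equiv.prodUnique (Fin n) (Fin 1)) (fun i => dD L e dV hdV dW hdW (Fin.castAdd n i)) (fun i => dD_conj L e dV hdV dW hdW (Fin.castAdd n i)) (lineW L (TW (Fp L) a')) (complexConj_lineW L (TW (Fp L) a'))) (-cmGramEntry L (Equiv.prodUnique (Fin n) (Fin 1)) (fun i => dD L e dV hdV dW hdW (Fin.castAdd n i)) (fun i => dD_conj L e dV hdV dW hdW (Fin.castAdd n i)) (lineW L (TW (Fp L) a')) (complexConj_lineW L (TW (Fp L) a'))) ((LocalSplitting.e₂ n).symm k)) (imagUnit L) σ)) (NegIdx (signVec (cmPlaceOver L) (fun k => Sum.elim (cmGramEntry L (Equiv.prodUnique (Fin n) (Fin 1)) (fun i => dD L e dV hdV dW hdW (Fin.castAdd n i)) (fun i => dD_conj L e dV hdV dW hdW (Fin.castAdd n i)) (lineW L (TW (Fp L) a')) (complexConj_lineW L (TW (Fp L) a'))) (-cmGramEntry L (Equiv.prodUnique (Fin n) (Fin 1)) (fun i =>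 dD L e dV hdV dW hdW (Fin.castAdd n i)) (fun i => dD_conj L e dV hdV dW hdW (Fin.castAdd n i)) (lineW L (TW (Fp L) a')) (complexConj_lineW L (TW (Fp L) a'))) ((LocalSplitting.e₂ n).symm k)) (imagUnit L) σ))).symm
                  (Equiv.refl (Fin (n + n) × {v : {v : InfinitePlace (Fp L) // v.IsReal} // v ≠ σ})))))).trans
                (schwartzTransport (reindexCLE (Equiv.sumCongr
                  (dpIdxCongr (PosIdx (signVec (cmPlaceOver L) (fun k => Sum.elim (cmGramEntry L (Equiv.prodUnique (Fin n) (Fin 1)) (fun i => dD L e dV hdV dW hdW (Fin.castAdd n i)) (fun i => dD_conj L e dV hdV dW hdW (Fin.castAdd n i)) (lineW L (TW (Fp L) a')) (complexConj_lineW L (TW (Fp L) a'))) (-cmGramEntry L (Equiv.prodUnique (Fin n) (Fin 1)) (fun i => dD L e dV hdV dW hdW (Fin.castAdd n i)) (fun i => dD_conj L e dV hdV dW hdW (Fin.castAdd n i)) (lineW L (TW (Fp L) a')) (complexConj_lineW L (TW (Fp L) a'))) ((LocalSplitting.e₂ n).symm k)) (imagUnit L) σ)) (NegIdx (signVec (cmPlaceOver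 L) (fun k => Sum.elim (cmGramEntry L (Equiv.prodUnique (Fin n) (Fin 1)) (fun i => dD L e dV hdV dW hdW (Fin.castAdd n i)) (fun i => dD_conj L e dV hdV dW hdW (Fin.castAdd n i)) (lineW L (TW (Fp L) a')) (complexConj_lineW L (TW (Fp L) a'))) (-cmGramEntry L (Equiv.prodUnique (Fin n) (Fin 1)) (fun i => dD L e dV hdV dW hdW (Fin.castAdd n i)) (fun i => dD_conj L e dV hdV dW hdW (Fin.castAdd n i)) (lineW L (TW (Fp L) a')) (complexConj_lineW L (TW (Fp L) a'))) ((LocalSplitting.e₂ n).symm k)) (imagUnit L) σ)) Unit Empty (Fin 2) (Fin 2) Unit Empty e₂P e₂Q (Equiv.refl Unit) (Equiv.refl Empty)).symm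
                  (Equiv.refl (Fin (n + n) × {v : {v : InfinitePlace (Fp L) // v.IsReal} // v ≠ σ})))))).symm (tensorPi Φ₁ Φ₂)))) hel).trans
        (archWeilRep_fst_placeSecJ_tensorPi L e dV hdV dW hdW e₁ hdV0 hdW0 lam hlam a' σ e₂P e₂Q
          (proj_chiSplittingLine_eq_toSp L e dV hdV dW hdW e₁ hdV0 hdW0 lam hlam a') htA hoddA _ Φ₁ Φ₂)))).trans
      (congrArg (fun v => ((etaD L (Equiv.prodUnique (Fin n) (Fin 1)) (fun i => dD L e dV hdV dW hdW (Fin.castAdd n i)) (fun i => dD_conj L e dV hdV dW hdW (Fin.castAdd n i)) (lineW L (TW (Fp L) a')) (complexConj_lineW L (TW (Fp L) a')) tA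
        (placeSecJ L (IsCMField.complexConj L) (n + n) (IsCMField.complexConj_ne_one L) (cmPlaceOver L) (cmPlaceOver_smul L) _
              (gramD_gram_realDiagonal_entry_ne_zero L (Equiv.prodUnique (Fin n) (Fin 1)) (fun i => dD L e dV hdV dW hdW (Fin.castAdd n i)) (fun i => dD_conj L e dV hdV dW hdW (Fin.castAdd n i)) (lineW L (TW (Fp L) a')) (complexConj_lineW L (TW (Fp L) a')) (fun i => dD_ne_zero L e dV hdV dW hdW hdV0 hdW0 (Fin.castAdd n i)) (lineW_ne_zero L (TW (Fp L) a') (isUnit_det_TW (Fp L) a'))) (complexConj_imagUnit L) (imagUnit_ne_zero L) σ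
              (cmPlaceOver_comap L) (gramD_eq_diagonal_cm L (Equiv.prodUnique (Fin n) (Fin 1)) (fun i => dD L e dV hdV dW hdW (Fin.castAdd n i)) (fun i => dD_conj L e dV hdV dW hdW (Fin.castAdd n i)) (lineW L (TW (Fp L) a')) (complexConj_lineW L (TW (Fp L) a'))) (J := hermD L (Equiv.prodUnique (Fin n) (Fin 1)) (fun i => dD L e dV hdV dW hdW (Fin.castAdd n i)) (fun i => dD_conj L e dV hdV dW hdW (Fin.castAdd n i)) (lineW L (TW (Fp L) a')) (complexConj_lineW L (TW (Fp L) a'))) rfl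
              (complexConj_smul_infinitePlace L) e₂P e₂Q ((((uFormGroup (Fin 2) (Fin 2)).expMem
                ⟨((t • Y : ↥(uFormGroup (Fin 2) (Fin 2)).lie.toSubmodule) : Matrix (Fin 2 ⊕ Fin 2) (Fin 2 ⊕ Fin 2) ℂ), (t • Y).2⟩ :
                UForm (Fin 2) (Fin 2)), (1 : UForm Unit Empty)) : Ginf (Fin 2) (Fin 2) Unit Empty)) : ℂˣ) : ℂ) • v) (hJ _)).symm
  · -- `hW0`: `W 0 = id` (`exp (0·Y) = 1`, ★ `expMem_zero_smul`; term mode — no rewriting under `placeSecJ`)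
    have h1 : (((((uFormGroup (Fin 2) (Fin 2)).expMem
                ⟨(((0 : ℝ) • Y : ↥(uFormGroup (Fin 2) (Fin 2)).lie.toSubmodule) : Matrix (Fin 2 ⊕ Fin 2) (Fin 2 ⊕ Fin 2) ℂ), ((0 : ℝ) • Y).2⟩ :
                UForm (Fin 2) (Fin 2)), (1 : UForm Unit Empty)) : Ginf (Fin 2) (Fin 2) Unit Empty)) = 1 :=
      Prod.ext (expMem_zero_smul Y) rfl
    exact (congrArg (fun u : Ginf (Fin 2) (Fin 2) Unit Empty => ((weilRep (α := (Fin 2 × Unit) ⊕ (Fin 2 × Empty)) (β := (Fin 2 × Empty) ⊕ (Fin 2 × Unit))).comp (toBig (Fin 2) (Fin 2) Unit Empty)) u Φ₁) h1).trans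
      ((LinearMap.congr_fun (map_one ((weilRep (α := (Fin 2 × Unit) ⊕ (Fin 2 × Empty)) (β := (Fin 2 × Empty) ⊕ (Fin 2 × Unit))).comp (toBig (Fin 2) (Fin 2) Unit Empty))) Φ₁).trans (Module.End.one_apply Φ₁))
  · -- `hη0`: `η 0 = 1`
    have h1 : (((((uFormGroup (Fin 2) (Fin 2)).expMem
                ⟨(((0 : ℝ) • Y : ↥(uFormGroup (Fin 2) (Fin 2)).lie.toSubmodule) : Matrix (Fin 2 ⊕ Fin 2) (Fin 2 ⊕ Fin 2) ℂ), ((0 : ℝ) • Y).2⟩ :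
                UForm (Fin 2) (Fin 2)), (1 : UForm Unit Empty)) : Ginf (Fin 2) (Fin 2) Unit Empty)) = 1 :=
      Prod.ext (expMem_zero_smul Y) rfl
    exact ((congrArg (fun u : Ginf (Fin 2) (Fin 2) Unit Empty => ((etaD L (Equiv.prodUnique (Fin n) (Fin 1)) (fun i => dD L e dV hdV dW hdW (Fin.castAdd n i)) (fun i => dD_conj L e dV hdV dW hdW (Fin.castAdd n i)) (lineW L (TW (Fp L) a')) (complexConj_lineW L (TW (Fp L) a')) tA
      ((placeSecJ L (IsCMField.complexConj L) (n + n) (IsCMField.complexConj_ne_one L) (cmPlaceOver L) (cmPlaceOver_smul L) _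
              (gramD_gram_realDiagonal_entry_ne_zero L (Equiv.prodUnique (Fin n) (Fin 1)) (fun i => dD L e dV hdV dW hdW (Fin.castAdd n i)) (fun i => dD_conj L e dV hdV dW hdW (Fin.castAdd n i)) (lineW L (TW (Fp L) a')) (complexConj_lineW L (TW (Fp L) a')) (fun i => dD_ne_zero L e dV hdV dW hdW hdV0 hdW0 (Fin.castAdd n i)) (lineW_ne_zero L (TW (Fp L) a') (isUnit_det_TW (Fp L) a'))) (complexConj_imagUnit L) (imagUnit_ne_zero L) σ
              (cmPlaceOver_comap L) (gramD_eq_diagonal_cm L (Equiv.prodUnique (Fin n) (Fin 1)) (fun i => dD L e dV hdV dW hdW (Fin.castAdd n i)) (fun i => dD_conj L e dV hdV dW hdW (Fin.castAdd n i)) (lineW L (TW (Fp L) a')) (complexConj_lineW L (TW (Fp L) a'))) (J := hermD L (Equiv.prodUnique (Fin n) (Fin 1)) (fun i => dD L e dV hdV dW hdW (Fin.castAdd n i)) (fun i => dD_conj L e dV hdV dW hdW (Fin.castAdd n i)) (lineW L (TW (Fp L) a')) (complexConj_lineW L (TW (Fp L) a'))) rfl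
              (complexConj_smul_infinitePlace L) e₂P e₂Q) u) : ℂˣ) : ℂ)) h1).trans
      (congrArg (fun z : ℂˣ => (z : ℂ)) ((congrArg (etaD L (Equiv.prodUnique (Fin n) (Fin 1)) (fun i => dD L e dV hdV dW hdW (Fin.castAdd n i)) (fun i => dD_conj L e dV hdV dW hdW (Fin.castAdd n i)) (lineW L (TW (Fp L) a')) (complexConj_lineW L (TW (Fp L) a')) tA) (map_one
        (placeSecJ L (IsCMField.complexConj L) (n + n) (IsCMField.complexConj_ne_one L) (cmPlaceOver L) (cmPlaceOver_smul L) _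
              (gramD_gram_realDiagonal_entry_ne_zero L (Equiv.prodUnique (Fin n) (Fin 1)) (fun i => dD L e dV hdV dW hdW (Fin.castAdd n i)) (fun i => dD_conj L e dV hdV dW hdW (Fin.castAdd n i)) (lineW L (TW (Fp L) a')) (complexConj_lineW L (TW (Fp L) a')) (fun i => dD_ne_zero L e dV hdV dW hdW hdV0 hdW0 (Fin.castAdd n i)) (lineW_ne_zero L (TW (Fp L) a') (isUnit_det_TW (Fp L) a'))) (complexConj_imagUnit L) (imagUnit_ne_zero L) σ
              (cmPlaceOver_comap L) (gramD_eq_diagonal_cm L (Equiv.prodUnique (Fin n) (Fin 1)) (fun i => dD L e dV hdV dW hdW (Fin.castAdd n i)) (fun i => dD_conj L e dV hdV dW hdW (Fin.castAdd n i)) (lineW L (TW (Fp L) a')) (complexConj_lineW L (TW (Fp L) a'))) (J := hermD L (Equiv.prodUnique (Fin n) (Fin 1)) (fun i => dD L e dV hdV dW hdW (Fin.castAdd n i)) (fun i => dD_conj L e dV hdV dW hdW (Fin.castAdd n i)) (lineW L (TW (Fp L) a')) (complexConj_lineW L (TW (Fp L) a'))) rfl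
              (complexConj_smul_infinitePlace L) e₂P e₂Q))).trans (map_one (etaD L (Equiv.prodUnique (Fin n) (Fin 1)) (fun i => dD L e dV hdV dW hdW (Fin.castAdd n i)) (fun i => dD_conj L e dV hdV dW hdW (Fin.castAdd n i)) (lineW L (TW (Fp L) a')) (complexConj_lineW L (TW (Fp L) a')) tA))))).trans Units.val_one

end Summit.HodgeConjecture.HodgeConjecture.Cruxes.HLiu418.K2LiuFaceGThetaOrbitLetter
end
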